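/-
Copyright: the b2b-balaban cell (near-miss cell 7), T⁴-continuum CRUX team (coordinator ruling e34b3e0c item (2)),
lineage t4-ne7b-formalise-leaf-02 (gen 127; E-side ∕ key-readings). Released under the licence of the surrounding project.
-/
import Summits.QuantumFields.BalabanUV.T4Continuum.Spine.NE7b.InducedMeanRegularityDecay
import Literature.MathematicalPhysics.QuantumFieldTheory.Balaban1983to89.B4Ineq116Torus

/-!
# (R1″) END TO END ON PRINT'S SCALAR FLUCTUATION COVARIANCE: the induced-mean energy of Bałaban's torus tower `C^{(j)}`
# ([B4] Prop. 2.3 (1.16) on the torus, as PROVED in `…Balaban1983to89.B4Ineq116Torus`), uniformly in the volume and the level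

Cell `pub-balaban/t4`, spine estimate NE7b (`T4WeightBudget.RelWeightBound`; the cell's OWN estimate — NOT PRINTED in
[Bałaban 1983–89], NOT PROVED).  A junction BY NAME of this lineage's `…InducedMeanRegularityDecay` (print's (5.6) ⇒ (5.7)
letters) with the lit-balaban Literature module `…Balaban1983to89.B4Ineq116Torus`, which PROVES [B4] = Bałaban, *Regularity and
decay of lattice Green's functions*, CMP **89** (1983), Prop. 2.3 (1.16) ON THE TORUS for the rescaled fluctuation covariance
`C^{(j)} = (aL^{−2}Q^*Q + Δ^{(j),resc})^{−1}` of his concrete SCALAR torus tower at trivial background (`U = 1`; `B1RG242Torus.tower`,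
`B4Ineq115Torus.Carg ∕ Crs`), via `Carg_hyp56` ((5.6) for the argument `aL^{−2}Q^*Q + Δ^{(j)}` with `γ₀ = gamma115u L a`,
`c₀ = c116 d′ L a κ M`, `δ₀ = κ∕(d′+1)`), `T_isPseudoDist ∕ T_sumBound` (the sup torus metric `T^{(j)}` in `L^jε`-units with the
volume-free profile `latticeConst (d′+1)`).  NOTHING of Bałaban's is asserted here: every analytic input is a THEOREM of the tree,
consumed by name; 0 `def`, 0 `sorry`; no `T4Continuum/Support` leaf (FREEZE (0)).

WHY.  The OWNER's memo `A1C-LCS-RESIDUAL-g105` §2 names the residual (R1″): «induced-mean energy bounds `mᵀQm ≤ B₀`, `B₀ = O(#Z)`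
independent of the volume, `m = S₁₁⁻¹S₁₂x₂`».  `…InducedMeanRegularityDecay.inducedMeanEnergy_le_of_hyp56` gives it from [B4] (5.6)
+ a lattice-sum profile + an interface reading + a buffer, and the crux refuter's F402 (v73) asks what remains: «(5.6) k-uniformly
for his step-k forms + a usable rate».  For the SCALAR prototype the tree already HAS (5.6) at every level `j` and every volume:
`B4Ineq116Torus.Carg_hyp56`.  THIS FILE plugs it in: the induced mean IS `C^{(j)}v` (`Crs = Carg⁻¹`, `Crs_eq`), and its `Q`-energy on
a pinned region `Z` is bounded with constants depending on `(d, L, a, m²₊)` ONLY — for every volume `(m, K)`, every mass `m² ≥ 0`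
under the cap, every level `1 ≤ j ≤ m + K`, every pinned form, interface and buffer.

WHAT IS PROVED ([folklore] junctions + tree theorems by name):
* §1 **`inducedMeanEnergy_le_scalarTower`** — at one volume and level, explicit constants: for `v` supported on the interface `D`
  with `|v| ≤ V`, `Q` positive semidefinite on `Z` with `Q ≤ q₀·1`, `0 < b ≤ δ₁`, buffer `T^{(j)}(Z, D) ≥ R`:
  `(C^{(j)}v)ᵀQ(C^{(j)}v) ≤ q₀·#Z·((2∕γ₀)·V·(latticeConst (d′+1) b · e^{−(δ₁−b)R}))²`, `γ₀ = gamma115u L a`,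
  `δ₁ = rate (latticeConst (d′+1)) γ₀ (c116 d′ L a κ M) (κ∕(d′+1))` under b04's decay package `DecayHyp d′ L a m²₊ κ M`
  (`decayHyp_exists`); `inducedMeanEnergy_le_scalarTower'` (the same with `Crs` named); `windowEnergy_le_scalarTower` ((R1′c)'s
  nesting letters `μ_b` for the scalar tower, `R = 0`: `≤ q_b·#Z_b·((2∕γ₀)·V·latticeConst (d′+1) δ₁)²`).
* §2 **`inducedMeanEnergy_le_scalarTower_uniform`** — print's quantifier order, mirroring `B4Ineq116Torus.cov116_torus`: for every
  `d ≥ 1`, odd `L > 1`, `a > 0`, `m²₊` THERE ARE `γ₀, δ₁ > 0` (functions of `d, L, a, m²₊` only) such that the §1 bound holds for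
  EVERY volume, mass under the cap, level, pinned form, interface and buffer — (R1″)'s «independent of the volume» for the scalar
  prototype, as a theorem.
NOT HERE (honest): the GAUGE-covariant fluctuation forms in a background (Bałaban's [B13]–[B16] objects; (5.6) k-uniformly for them
is the (A1c) READING), the interface reading `D, V` and the buffer width at print's operating point (refuter κ-ne7bref-g68-5: the
tree's `rate` is the Combes–Thomas worst case — a usable RATE is print's direct propagator theorems' business), the window clause
(R1′c), (R2′), (A3).  BY-NAME EFFECT ON THE WALL: NONE (a model ∕ prototype supplier: the (R1″) letter is a THEOREM for the scalar
tower's `C^{(j)}` — not for the row's gauge-field instance).  NE7b NOT PRINTED ∕ NOT PROVED; spine PROVED 0∕9; rung (B)+1 on ONE finite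
T⁴ — NOT infinite volume, NOT the mass gap, NOT Clay.  HONEST DEPENDENCY: continuum YM on T⁴ ⇐ BetaPertH ∧ nine spine estimates
(0∕9 proved); BetaPertH ⇐ (D1) ∧ (D4) ∧ CAP+tail; G-an2-4 gates asym, D1 and NE2∕3∕4.
-/

set_option autoImplicit false
open Matrix Finset Real
open Literature.MathematicalPhysics.QuantumFieldTheory.Balaban1983to89
open Literature.MathematicalPhysics.QuantumFieldTheory.Balaban1983to89.B4Sect5Torus
open Literature.MathematicalPhysics.QuantumFieldTheory.Balaban1983to89.B1RG242Torus
open Literature.MathematicalPhysics.QuantumFieldTheory.Balaban1983to89.B4Ineq115Torus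
open Literature.MathematicalPhysics.QuantumFieldTheory.Balaban1983to89.B5Display136Torus
open Literature.MathematicalPhysics.QuantumFieldTheory.Balaban1983to89.B4Ineq116Torus
open Literature.MathematicalPhysics.QuantumFieldTheory.Balaban1983to89.B5Ineq137Torus
open Literature.MathematicalPhysics.QuantumFieldTheory.Balaban1983to89.B5Leaf237C0Torus
open Summit.QuantumFields.BalabanUV.T4Continuum.NE7b.InducedMeanRegularityDecay

namespace Summit.QuantumFields.BalabanUV.T4Continuum.NE7b.InducedMeanScalarTower

/-! ## §1 One volume, one level: explicit constants -/

section OneLevel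
variable (d' Lb mb Kb : ℕ) (hL : Odd Lb ∧ 1 < Lb) [NeZero Lb]

local notation "Pm" => B4Ineq116Torus.mkP d' Lb mb Kb hL

/-- **(R1″) FOR THE SCALAR TOWER's `C^{(j)}`, EXPLICIT.**  On the level-`j` torus `T^{(j)}` of Bałaban's concrete scalar tower
(`P = (d′+1, L, m, K)`, `1 ≤ j ≤ m + K`, mass cap `(L^jε)²m² ≤ m²₊`, b04's decay package `DecayHyp d′ L a m²₊ κ M`), let
`S = aL^{−2}Q^*Q + Δ^{(j)}` (`Carg`) be the argument of the fluctuation covariance, `v` an exterior term supported on the interface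
`D` with `|v| ≤ V` (`V ≥ 0`), `Q` positive semidefinite living on the pinned region `Z` with `Q ≤ q₀·1` (`q₀ ≥ 0`), `0 < b ≤ δ₁` and the
buffer `T^{(j)}(i, l) ≥ R` for `i ∈ Z`, `l ∈ D`.  Then the induced mean `m = S⁻¹v = C^{(j)}v` obeys
`mᵀQm ≤ q₀·#Z·((2∕γ₀)·V·(latticeConst (d′+1) b·e^{−(δ₁−b)R}))²`, `γ₀ = gamma115u L a`,
`δ₁ = rate (latticeConst (d′+1)) γ₀ (c116 d′ L a κ M) (κ∕(d′+1))` — no `#D`, no volume, no level.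
[tree theorems by name: `B4Ineq116Torus.Carg_hyp56`, `B5Leaf237C0Torus.T_isPseudoDist ∕ T_sumBound`; junction folklore] -/
theorem inducedMeanEnergy_le_scalarTower {a m2plus κ M : ℝ} (ha : 0 < a) (hκ : 0 < κ) (hM : 0 ≤ M)
    (hdec : DecayHyp d' Lb a m2plus κ M) {msq : ℝ} (hmsq : 0 ≤ msq) {j : ℕ} (hj1 : 1 ≤ j) (hj : j ≤ mb + Kb)
    (hcap : (Pm).spacing j ^ 2 * msq ≤ m2plus)
    (Q : Matrix (Site Pm j) (Site Pm j) ℝ) (hQ : Q.PosSemidef) (Z : Finset (Site Pm j))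
    (hQZ : ∀ i k, k ∉ Z → Q i k = 0) {q₀ : ℝ} (hq₀ : 0 ≤ q₀)
    (hQq : (q₀ • (1 : Matrix (Site Pm j) (Site Pm j) ℝ) - Q).PosSemidef)
    (D : Finset (Site Pm j)) (v : Site Pm j → ℝ) (hvD : ∀ l, l ∉ D → v l = 0) {V : ℝ} (hV0 : 0 ≤ V)
    (hV : ∀ l ∈ D, |v l| ≤ V) {b : ℝ} (hb : 0 < b)
    (hb' : b ≤ rate (B4Sect5Proof.latticeConst (d' + 1)) (gamma115u (Lb : ℝ) a) (c116 d' Lb a κ M) (κ / (d' + 1)))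
    {R : ℝ} (hR : ∀ i ∈ Z, ∀ l ∈ D, R ≤ T Pm j i l) :
    ((Carg Pm a msq j)⁻¹ *ᵥ v) ⬝ᵥ (Q *ᵥ ((Carg Pm a msq j)⁻¹ *ᵥ v)) ≤
      q₀ * Z.card * (2 / gamma115u (Lb : ℝ) a * V * (B4Sect5Proof.latticeConst (d' + 1) b *
        exp (-((rate (B4Sect5Proof.latticeConst (d' + 1)) (gamma115u (Lb : ℝ) a) (c116 d' Lb a κ M) (κ / (d' + 1)) - b) *
          R)))) ^ 2 := by
  have hL1 : (1 : ℝ) < Lb := by exact_mod_cast hL.2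
  exact inducedMeanEnergy_le_of_hyp56 (K := B4Sect5Proof.latticeConst (d' + 1))
    (fun _ hb0 => B4Sect5Proof.latticeConst_nonneg (d' + 1) hb0.le) (gamma115u_pos ha hL1)
    (c116_nonneg d' Lb ha hκ hM) (by positivity) (T_isPseudoDist Pm j) (T_sumBound Pm j)
    (Carg_hyp56 d' Lb mb Kb hL ha hκ hM hdec hmsq hj1 hj hcap) Q hQ Z hQZ hq₀ hQq D v hvD hV0 hV hb hb' hR

/-- **The same with the covariance NAMED**: the induced mean is `C^{(j)}v` (`B5Display136Torus.Crs = Carg⁻¹`, `Crs_eq`). [junction] -/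
theorem inducedMeanEnergy_le_scalarTower' {a m2plus κ M : ℝ} (ha : 0 < a) (hκ : 0 < κ) (hM : 0 ≤ M)
    (hdec : DecayHyp d' Lb a m2plus κ M) {msq : ℝ} (hmsq : 0 ≤ msq) {j : ℕ} (hj1 : 1 ≤ j) (hj : j ≤ mb + Kb)
    (hcap : (Pm).spacing j ^ 2 * msq ≤ m2plus)
    (Q : Matrix (Site Pm j) (Site Pm j) ℝ) (hQ : Q.PosSemidef) (Z : Finset (Site Pm j))
    (hQZ : ∀ i k, k ∉ Z → Q i k = 0) {q₀ : ℝ} (hq₀ : 0 ≤ q₀)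
    (hQq : (q₀ • (1 : Matrix (Site Pm j) (Site Pm j) ℝ) - Q).PosSemidef)
    (D : Finset (Site Pm j)) (v : Site Pm j → ℝ) (hvD : ∀ l, l ∉ D → v l = 0) {V : ℝ} (hV0 : 0 ≤ V)
    (hV : ∀ l ∈ D, |v l| ≤ V) {b : ℝ} (hb : 0 < b)
    (hb' : b ≤ rate (B4Sect5Proof.latticeConst (d' + 1)) (gamma115u (Lb : ℝ) a) (c116 d' Lb a κ M) (κ / (d' + 1)))
    {R : ℝ} (hR : ∀ i ∈ Z, ∀ l ∈ D, R ≤ T Pm j i l) :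
    (Crs Pm a msq j *ᵥ v) ⬝ᵥ (Q *ᵥ (Crs Pm a msq j *ᵥ v)) ≤
      q₀ * Z.card * (2 / gamma115u (Lb : ℝ) a * V * (B4Sect5Proof.latticeConst (d' + 1) b *
        exp (-((rate (B4Sect5Proof.latticeConst (d' + 1)) (gamma115u (Lb : ℝ) a) (c116 d' Lb a κ M) (κ / (d' + 1)) - b) *
          R)))) ^ 2 := by
  rw [Crs_eq]
  exact inducedMeanEnergy_le_scalarTower d' Lb mb Kb hL ha hκ hM hdec hmsq hj1 hj hcap Q hQ Z hQZ hq₀ hQq D v hvD hV0 hV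
    hb hb' hR

/-- **THE NESTING LETTERS FOR THE SCALAR TOWER** ((R1′c)'s `μ_b`, windows touching the interface, `R = 0`): for a window form
`Q_b` living on `Z_b ⊆ T^{(j)}` with `Q_b ≤ q_b·1` and an exterior term on `D` with `|v| ≤ V`,
`(C^{(j)}v)ᵀQ_b(C^{(j)}v) ≤ q_b·#Z_b·((2∕γ₀)·V·latticeConst (d′+1) δ₁)²`, `δ₁ = rate …` — no `#D`, no volume, no level
(= (3)'s `windowEnergy_le_of_sumBound` at `hdec := inv_decay … (Carg_hyp56 …)`). [tree theorems by name; junction] -/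
theorem windowEnergy_le_scalarTower {a m2plus κ M : ℝ} (ha : 0 < a) (hκ : 0 < κ) (hM : 0 ≤ M)
    (hdec : DecayHyp d' Lb a m2plus κ M) {msq : ℝ} (hmsq : 0 ≤ msq) {j : ℕ} (hj1 : 1 ≤ j) (hj : j ≤ mb + Kb)
    (hcap : (Pm).spacing j ^ 2 * msq ≤ m2plus)
    (Qb : Matrix (Site Pm j) (Site Pm j) ℝ) (hQb : Qb.PosSemidef) (Zb : Finset (Site Pm j))
    (hQZ : ∀ i k, k ∉ Zb → Qb i k = 0) {qb : ℝ} (hqb : 0 ≤ qb)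
    (hQq : (qb • (1 : Matrix (Site Pm j) (Site Pm j) ℝ) - Qb).PosSemidef)
    (D : Finset (Site Pm j)) (v : Site Pm j → ℝ) (hvD : ∀ l, l ∉ D → v l = 0) {V : ℝ} (hV0 : 0 ≤ V)
    (hV : ∀ l ∈ D, |v l| ≤ V) :
    (Crs Pm a msq j *ᵥ v) ⬝ᵥ (Qb *ᵥ (Crs Pm a msq j *ᵥ v)) ≤
      qb * Zb.card * (2 / gamma115u (Lb : ℝ) a * V * B4Sect5Proof.latticeConst (d' + 1)
        (rate (B4Sect5Proof.latticeConst (d' + 1)) (gamma115u (Lb : ℝ) a) (c116 d' Lb a κ M) (κ / (d' + 1)))) ^ 2 := by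
  have hL1 : (1 : ℝ) < Lb := by exact_mod_cast hL.2
  have hK : ∀ b : ℝ, 0 < b → 0 ≤ B4Sect5Proof.latticeConst (d' + 1) b :=
    fun _ hb0 => B4Sect5Proof.latticeConst_nonneg (d' + 1) hb0.le
  rw [Crs_eq]
  exact windowEnergy_le_of_sumBound (Carg Pm a msq j) Qb (T_isPseudoDist Pm j)
    (rate_pos hK (gamma115u_pos ha hL1) (c116_nonneg d' Lb ha hκ hM) (by positivity))
    (inv_decay hK (gamma115u_pos ha hL1) (c116_nonneg d' Lb ha hκ hM) (by positivity) (T_isPseudoDist Pm j)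
      (T_sumBound Pm j) (Carg_hyp56 d' Lb mb Kb hL ha hκ hM hdec hmsq hj1 hj hcap))
    hQb Zb hQZ hqb hQq D v hvD hV0 hV (T_sumBound Pm j)

end OneLevel

/-! ## §2 Print's quantifier order: constants from `(d, L, a, m²₊)` ONLY, for every volume and level -/

/-- **(R1″) FOR THE SCALAR TOWER, UNIFORMLY IN THE VOLUME AND THE LEVEL** (the packaging of `B4Ineq116Torus.cov116_torus`).
For every dimension `d ≥ 1`, odd `L > 1`, `a > 0` and mass cap `m²₊` THERE ARE `γ₀ > 0` and `δ₁ > 0`, depending on `d, L, a, m²₊`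
ONLY, such that for EVERY volume (`m, K`), every `m² ≥ 0`, every level `1 ≤ j ≤ m + K` with `(L^jε)²m² ≤ m²₊`, every positive
semidefinite `Q` living on a pinned region `Z ⊆ T^{(j)}` with `Q ≤ q₀·1`, every exterior term `v` supported on an interface `D` with
`|v| ≤ V`, every rate `0 < b ≤ δ₁` and every buffer `R` with `T^{(j)}(Z, D) ≥ R`:
`(C^{(j)}v)ᵀQ(C^{(j)}v) ≤ q₀·#Z·((2∕γ₀)·V·(latticeConst d b·e^{−(δ₁−b)R}))²`. [tree theorems by name; junction folklore] -/
theorem inducedMeanEnergy_le_scalarTower_uniform (d L : ℕ) (hd : 1 ≤ d) (hL : Odd L ∧ 1 < L) {a : ℝ} (ha : 0 < a)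
    (m2plus : ℝ) :
    ∃ γ₀ δ₁ : ℝ, 0 < γ₀ ∧ 0 < δ₁ ∧ ∀ (P : Params), P.d = d → P.L = L → ∀ (msq : ℝ), 0 ≤ msq →
      ∀ j : ℕ, 1 ≤ j → j ≤ P.m + P.K → P.spacing j ^ 2 * msq ≤ m2plus →
        ∀ (Q : Matrix (Site P j) (Site P j) ℝ), Q.PosSemidef → ∀ (Z : Finset (Site P j)),
          (∀ i k, k ∉ Z → Q i k = 0) → ∀ (q₀ : ℝ), 0 ≤ q₀ → (q₀ • (1 : Matrix (Site P j) (Site P j) ℝ) - Q).PosSemidef →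
          ∀ (D : Finset (Site P j)) (v : Site P j → ℝ), (∀ l, l ∉ D → v l = 0) → ∀ (V : ℝ), 0 ≤ V →
            (∀ l ∈ D, |v l| ≤ V) → ∀ (b : ℝ), 0 < b → b ≤ δ₁ → ∀ (R : ℝ), (∀ i ∈ Z, ∀ l ∈ D, R ≤ T P j i l) →
              (Crs P a msq j *ᵥ v) ⬝ᵥ (Q *ᵥ (Crs P a msq j *ᵥ v)) ≤
                q₀ * Z.card * (2 / γ₀ * V * (B4Sect5Proof.latticeConst d b * exp (-((δ₁ - b) * R)))) ^ 2 := by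
  obtain ⟨d', rfl⟩ : ∃ d', d = d' + 1 := ⟨d - 1, by omega⟩
  haveI : NeZero L := ⟨by have := hL.2; omega⟩
  have hL1 : (1 : ℝ) < L := by exact_mod_cast hL.2
  obtain ⟨κ, M, hκ, hM, hdec⟩ := decayHyp_exists d' L ha hL1 m2plus
  refine ⟨gamma115u (L : ℝ) a,
    rate (B4Sect5Proof.latticeConst (d' + 1)) (gamma115u (L : ℝ) a) (c116 d' L a κ M) (κ / (d' + 1)),
    gamma115u_pos ha hL1,
    rate_pos (fun _ hb => B4Sect5Proof.latticeConst_nonneg (d' + 1) hb.le) (gamma115u_pos ha hL1)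
      (c116_nonneg d' L ha hκ hM) (by positivity), ?_⟩
  intro P hPd hPL msq hmsq j hj1 hj hcap Q hQ Z hQZ q₀ hq₀ hQq D v hvD V hV0 hV b hb hb' R hR
  obtain ⟨dP, LP, mP, KP, hdP, hLP⟩ := P
  simp only at hPd hPL
  subst hPd hPL
  exact inducedMeanEnergy_le_scalarTower' d' LP mP KP hLP ha hκ hM hdec hmsq hj1 hj hcap Q hQ Z hQZ hq₀ hQq D v hvD hV0
    hV hb hb' hR

end Summit.QuantumFields.BalabanUV.T4Continuum.NE7b.InducedMeanScalarTower
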